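import Literature.Probability.Percolation.CornerPercolation
import Literature.Probability.Percolation.ProdBernoulliRusso
import HarnessLib

/-!
# Stub `stub_tilt` (crux stmt-CriticalPhenomena-5476 `UniformBoxCrossing`, line `Sketch`,
# v4 microcanonical composition): the tilt identity of the corner family

For an event `E` of bond configurations of `ℤ²` whose coin-space form `{S | cornerConfig S ∈ E}`
is determined by the coins and splitting bits of a finite set `F` of vertices,

  `M_t(E) = 2^{|F|} Σ_{k ≤ |F|} (t/2)^k (1 - t/2)^{|F|-k} · M_1(E ∩ {exactly k corners of F disagree})`,

where the corner of `v` DISAGREES in `ω` when exactly one of its east and north edges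
`cornerEdge (v, 0)`, `cornerEdge (v, 1)` is open (`M_t = cornerPercolation t`). In coin space a
corner disagrees iff its splitting bit `(v, 1)` is on (`cornerEdge_mem_cornerConfig_iff`), and
`M_t`, `M_1` are the images of `prodBernoulli (cornerParam t)`, `prodBernoulli (cornerParam 1)`,
which differ only in the bias `t/2` versus `1/2` of the splitting bits.

Proof: expand both sides over the cylinders `[T]_K`, `T ⊆ K = F × {0, 1}`
(`RussoPath.prodBernoulli_real_eq_sum_powerset`). The weight of `[T]_K` is
`(1/2)^{|F|} (t/2)^{k(T)} (1 - t/2)^{|F| - k(T)}` under `cornerParam t` and `(1/2)^{2|F|}` under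
`cornerParam 1`, where `k(T) = #{v ∈ F | (v, 1) ∈ T}` is the number of disagreeing corners of the
configurations in `[T]_K`; after exchanging the two sums on the right the expansions agree term by
term.
-/

noncomputable section

namespace Summit.CriticalPhenomena.CardyFormulaZ2.Cruxes.UniformBoxCrossing.Microcanonical

open MeasureTheory Complex Literature.Probability.Percolation Literature.Probability.LatticeModels

/-- In the corner configuration of `S` the corner at `v` disagrees (exactly one of its east and
north edges is open) iff the splitting bit `(v, 1)` is on. -/
private theorem xor_cornerEdge_mem_cornerConfig_iff (S : Set (Site 2 × Fin 2)) (v : Site 2) :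
    Xor (cornerEdge (v, 0) ∈ cornerConfig S) (cornerEdge (v, 1) ∈ cornerConfig S) ↔
      (v, 1) ∈ S := by
  simp only [cornerEdge_mem_cornerConfig_iff, cornerBit_zero, cornerBit_one]
  unfold Xor
  tauto

/-- Hence the set of disagreeing corners of `F` in `cornerConfig S` is the set of `v ∈ F` whose
splitting bit is on. -/
private theorem disagreeSet_cornerConfig (F : Finset (Site 2)) (S : Set (Site 2 × Fin 2)) :
    {v : Site 2 | v ∈ (↑F : Set (Site 2)) ∧
        Xor (cornerEdge (v, 0) ∈ cornerConfig S) (cornerEdge (v, 1) ∈ cornerConfig S)} =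
      {v : Site 2 | v ∈ (↑F : Set (Site 2)) ∧ (v, 1) ∈ S} :=
  Set.ext fun v => and_congr_right fun _ => xor_cornerEdge_mem_cornerConfig_iff S v

/-- The event "exactly `k` corners of `F` disagree" is determined by the `2|F|` lattice edges at
the corners of `F` (in particular it is measurable). -/
private theorem determinedBy_disagreeCount (F : Finset (Site 2)) (k : ℕ) :
    DeterminedBy {ω : BondConfig (Site 2) | Set.ncard {v : Site 2 | v ∈ (↑F : Set (Site 2)) ∧
        Xor (cornerEdge (v, 0) ∈ ω) (cornerEdge (v, 1) ∈ ω)} = k}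
      ↑((F ×ˢ (Finset.univ : Finset (Fin 2))).image cornerEdge) := by
  rw [determinedBy_iff]
  intro ω ω' h
  have key : ∀ v ∈ F, ∀ j : Fin 2, (cornerEdge (v, j) ∈ ω ↔ cornerEdge (v, j) ∈ ω') := by
    intro v hv j
    have hmem : cornerEdge (v, j) ∈
        (↑((F ×ˢ (Finset.univ : Finset (Fin 2))).image cornerEdge) : Set (Sym2 (Site 2))) :=
      Finset.mem_coe.2
        (Finset.mem_image_of_mem _ (Finset.mem_product.2 ⟨hv, Finset.mem_univ _⟩))
    exact ⟨fun hω => ((Set.ext_iff.1 h _).1 ⟨hω, hmem⟩).1,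
      fun hω => ((Set.ext_iff.1 h _).2 ⟨hω, hmem⟩).1⟩
  have hset : {v : Site 2 | v ∈ (↑F : Set (Site 2)) ∧
        Xor (cornerEdge (v, 0) ∈ ω) (cornerEdge (v, 1) ∈ ω)} =
      {v : Site 2 | v ∈ (↑F : Set (Site 2)) ∧
        Xor (cornerEdge (v, 0) ∈ ω') (cornerEdge (v, 1) ∈ ω')} := by
    ext v
    refine and_congr_right fun hv => ?_
    rw [key v hv 0, key v hv 1]
  change Set.ncard _ = k ↔ Set.ncard _ = k
  rw [hset]

/-- The coin-space event "exactly `k` splitting bits of `F` are on" is determined by the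
coordinates `F × {0, 1}`. -/
private theorem determinedBy_splitCount (F : Finset (Site 2)) (k : ℕ) :
    DeterminedBy {S : Set (Site 2 × Fin 2) | Set.ncard {v : Site 2 | v ∈ (↑F : Set (Site 2)) ∧
        (v, 1) ∈ S} = k} ↑(F ×ˢ (Finset.univ : Finset (Fin 2))) := by
  rw [determinedBy_iff]
  intro S S' h
  have key : ∀ v ∈ F, ((v, (1 : Fin 2)) ∈ S ↔ (v, (1 : Fin 2)) ∈ S') := by
    intro v hv
    have hmem : (v, (1 : Fin 2)) ∈
        (↑(F ×ˢ (Finset.univ : Finset (Fin 2))) : Set (Site 2 × Fin 2)) :=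
      Finset.mem_coe.2 (Finset.mem_product.2 ⟨hv, Finset.mem_univ _⟩)
    exact ⟨fun hS => ((Set.ext_iff.1 h _).1 ⟨hS, hmem⟩).1,
      fun hS => ((Set.ext_iff.1 h _).2 ⟨hS, hmem⟩).1⟩
  have hset : {v : Site 2 | v ∈ (↑F : Set (Site 2)) ∧ (v, 1) ∈ S} =
      {v : Site 2 | v ∈ (↑F : Set (Site 2)) ∧ (v, 1) ∈ S'} :=
    Set.ext fun v => and_congr_right fun hv => key v hv
  change Set.ncard _ = k ↔ Set.ncard _ = k
  rw [hset]

/-- The cylinder weights of the corner parameters over `K = F × {0, 1}`: the coin `(v, 0)`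
contributes `1/2` whatever its state, the splitting bit `(v, 1)` contributes `t/2` if on and
`1 - t/2` if off, so `∏_{i ∈ K} w_i(T) = (1/2)^{|F|} (t/2)^{k} (1 - t/2)^{|F| - k}` with
`k = #{v ∈ F | (v, 1) ∈ T}`. -/
private theorem prod_weight_cornerParam (t : unitInterval) (F : Finset (Site 2))
    (T : Finset (Site 2 × Fin 2)) :
    ∏ i ∈ F ×ˢ (Finset.univ : Finset (Fin 2)),
        (if i ∈ T then ((cornerParam t i : unitInterval) : ℝ) else 1 - (cornerParam t i : ℝ)) =
      (1 / 2) ^ F.card *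
        (((t : ℝ) / 2) ^
            Set.ncard {v : Site 2 | v ∈ (↑F : Set (Site 2)) ∧ (v, 1) ∈ (↑T : Set (Site 2 × Fin 2))} *
          (1 - (t : ℝ) / 2) ^ (F.card -
            Set.ncard {v : Site 2 | v ∈ (↑F : Set (Site 2)) ∧ (v, 1) ∈ (↑T : Set (Site 2 × Fin 2))})) := by
  have hN : Set.ncard {v : Site 2 | v ∈ (↑F : Set (Site 2)) ∧ (v, 1) ∈ (↑T : Set (Site 2 × Fin 2))} =
      (F.filter fun v => (v, (1 : Fin 2)) ∈ T).card := by
    rw [← Set.ncard_coe_finset, Finset.coe_filter]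
    rfl
  have hN' : (F.filter fun v => ¬ (v, (1 : Fin 2)) ∈ T).card =
      F.card - (F.filter fun v => (v, (1 : Fin 2)) ∈ T).card := by
    have := Finset.card_filter_add_card_filter_not (s := F) (fun v => (v, (1 : Fin 2)) ∈ T)
    omega
  have h2 : ∀ v : Site 2, ∏ j : Fin 2, (if (v, j) ∈ T then ((cornerParam t (v, j) : unitInterval) : ℝ)
      else 1 - (cornerParam t (v, j) : ℝ)) =
      1 / 2 * (if (v, (1 : Fin 2)) ∈ T then (t : ℝ) / 2 else 1 - (t : ℝ) / 2) := by
    intro v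
    rw [Fin.prod_univ_two, cornerParam_apply_zero, coe_half, coe_cornerParam_apply_one]
    split_ifs <;> ring
  rw [hN, Finset.prod_product]
  simp_rw [h2]
  rw [Finset.prod_mul_distrib, Finset.prod_const, Finset.prod_ite, Finset.prod_const,
    Finset.prod_const, hN']

/-- At `t = 1` every coordinate is a fair coin, so every cylinder `[T]_K` over `K = F × {0, 1}`
has weight `(1/2)^{|F|} (1/2)^{|F|}`. -/
private theorem prod_weight_cornerParam_one (F : Finset (Site 2)) (T : Finset (Site 2 × Fin 2)) :
    ∏ i ∈ F ×ˢ (Finset.univ : Finset (Fin 2)),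
        (if i ∈ T then ((cornerParam 1 i : unitInterval) : ℝ) else 1 - (cornerParam 1 i : ℝ)) =
      (1 / 2) ^ F.card * (1 / 2) ^ F.card := by
  have h : ∀ i : Site 2 × Fin 2, (if i ∈ T then ((cornerParam 1 i : unitInterval) : ℝ)
      else 1 - (cornerParam 1 i : ℝ)) = 1 / 2 := by
    intro i
    simp only [cornerParam_one, coe_half]
    split_ifs <;> norm_num
  simp_rw [h]
  rw [Finset.prod_const, Finset.card_product, Finset.card_univ, Fintype.card_fin, ← pow_add,
    mul_two]

/-- `(1/2)^n y = 2^n · y · (1/2)^n (1/2)^n`. -/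
private theorem half_pow_mul (n : ℕ) (y : ℝ) :
    (1 / 2 : ℝ) ^ n * y = 2 ^ n * (y * ((1 / 2) ^ n * (1 / 2) ^ n)) := by
  have h : (2 : ℝ) ^ n * (1 / 2) ^ n = 1 := by rw [← mul_pow]; norm_num
  calc (1 / 2 : ℝ) ^ n * y = 2 ^ n * (1 / 2) ^ n * ((1 / 2) ^ n * y) := by rw [h, one_mul]
    _ = 2 ^ n * (y * ((1 / 2) ^ n * (1 / 2) ^ n)) := by ring

/-- **Stub B: the tilt identity of the corner family.** For an event `E` whose coin-space form is
determined by the coins of a finite set `F` of vertices,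
`P_t(E) = 2^{|F|} Σ_k (t/2)^k (1-t/2)^{|F|-k} P_1(E ∩ {exactly k corners of F disagree})`: in coin
space `M_t = prodBernoulli (cornerParam t)` differs from `M_1` only in the bias `t/2` of the
splitting bits `(v, 1)`, `v ∈ F`, and a corner disagrees iff its splitting bit is on; expanding
both sides over the cylinders of `F × {0, 1}` (`RussoPath.prodBernoulli_real_eq_sum_powerset`),
the cylinder `[T]` weighs `(1/2)^{|F|} (t/2)^k (1-t/2)^{|F|-k}` under `M_t` and `(1/2)^{2|F|}`
under `M_1`, `k` its number of disagreeing corners, and the two expansions agree term by term. -/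
theorem stub_tilt :
    ∀ (t : unitInterval) (F : Finset (Site 2)) (E : Set (BondConfig (Site 2))),
      MeasurableSet E →
      DeterminedBy {S : Set (Site 2 × Fin 2) | cornerConfig S ∈ E}
        ↑(F ×ˢ (Finset.univ : Finset (Fin 2))) →
      (cornerPercolation t).real E =
        2 ^ F.card * ∑ k ∈ Finset.range (F.card + 1),
          ((t : ℝ) / 2) ^ k * (1 - (t : ℝ) / 2) ^ (F.card - k) *
            (cornerPercolation 1).real
              (E ∩ {ω | Set.ncard {v : Site 2 | v ∈ (↑F : Set (Site 2)) ∧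
                Xor (cornerEdge (v, 0) ∈ ω) (cornerEdge (v, 1) ∈ ω)} = k}) := by
  intro t F E hE hdet
  -- the level sets of the number of disagreeing corners are measurable cylinder events
  have hCm : ∀ k : ℕ, MeasurableSet {ω : BondConfig (Site 2) | Set.ncard {v : Site 2 |
      v ∈ (↑F : Set (Site 2)) ∧ Xor (cornerEdge (v, 0) ∈ ω) (cornerEdge (v, 1) ∈ ω)} = k} :=
    fun k => (determinedBy_disagreeCount F k).measurableSet_of_finset
  -- their coin-space forms: exactly `k` splitting bits of `F` are on
  have hpre : ∀ k : ℕ, cornerConfig ⁻¹' (E ∩ {ω : BondConfig (Site 2) | Set.ncard {v : Site 2 |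
      v ∈ (↑F : Set (Site 2)) ∧ Xor (cornerEdge (v, 0) ∈ ω) (cornerEdge (v, 1) ∈ ω)} = k}) =
      {S : Set (Site 2 × Fin 2) | cornerConfig S ∈ E} ∩
        {S : Set (Site 2 × Fin 2) | Set.ncard {v : Site 2 | v ∈ (↑F : Set (Site 2)) ∧
          (v, 1) ∈ S} = k} := by
    intro k
    ext S
    change cornerConfig S ∈ E ∧ Set.ncard {v : Site 2 | v ∈ (↑F : Set (Site 2)) ∧
        Xor (cornerEdge (v, 0) ∈ cornerConfig S) (cornerEdge (v, 1) ∈ cornerConfig S)} = k ↔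
      cornerConfig S ∈ E ∧ Set.ncard {v : Site 2 | v ∈ (↑F : Set (Site 2)) ∧ (v, 1) ∈ S} = k
    rw [disagreeSet_cornerConfig]
  have hstep : ∀ k : ℕ, (cornerPercolation 1).real (E ∩ {ω : BondConfig (Site 2) |
      Set.ncard {v : Site 2 | v ∈ (↑F : Set (Site 2)) ∧
        Xor (cornerEdge (v, 0) ∈ ω) (cornerEdge (v, 1) ∈ ω)} = k}) =
      (prodBernoulli (cornerParam 1)).real ({S : Set (Site 2 × Fin 2) | cornerConfig S ∈ E} ∩
        {S : Set (Site 2 × Fin 2) | Set.ncard {v : Site 2 | v ∈ (↑F : Set (Site 2)) ∧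
          (v, 1) ∈ S} = k}) := fun k => by
    rw [cornerPercolation_real_apply 1 (hE.inter (hCm k)), hpre k]
  -- cylinder expansions of both sides
  have hR := fun k : ℕ =>
    RussoPath.prodBernoulli_real_eq_sum_powerset (hdet.inter (determinedBy_splitCount F k))
      (cornerParam 1)
  rw [cornerPercolation_real_apply t hE]
  change (prodBernoulli (cornerParam t)).real {S : Set (Site 2 × Fin 2) | cornerConfig S ∈ E} = _
  rw [RussoPath.prodBernoulli_real_eq_sum_powerset hdet (cornerParam t)]
  simp_rw [hstep, hR, prod_weight_cornerParam_one, prod_weight_cornerParam t F, Finset.mul_sum]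
  rw [Finset.sum_comm]
  refine Finset.sum_congr rfl fun T _ => ?_
  by_cases hTB : (↑T : Set (Site 2 × Fin 2)) ∈ {S : Set (Site 2 × Fin 2) | cornerConfig S ∈ E}
  · -- the cylinder `[T]` lies in the event: compare the two weights
    rw [if_pos hTB]
    have hTB' : cornerConfig (↑T : Set (Site 2 × Fin 2)) ∈ E := hTB
    simp only [Set.mem_inter_iff, Set.mem_setOf_eq, hTB', true_and, mul_ite, mul_zero,
      Finset.sum_ite_eq, Finset.mem_range]
    split_ifs with hlt
    · exact half_pow_mul _ _
    · exfalso
      refine hlt (Nat.lt_succ_of_le ?_)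
      calc _ ≤ Set.ncard (↑F : Set (Site 2)) := Set.ncard_le_ncard (fun v hv => hv.1) F.finite_toSet
        _ = F.card := Set.ncard_coe_finset F
  · -- the cylinder `[T]` misses the event: both sides vanish
    rw [if_neg hTB]
    have hTB' : cornerConfig (↑T : Set (Site 2 × Fin 2)) ∉ E := hTB
    simp only [Set.mem_inter_iff, Set.mem_setOf_eq, hTB', false_and, if_false, mul_zero,
      Finset.sum_const_zero]

end Summit.CriticalPhenomena.CardyFormulaZ2.Cruxes.UniformBoxCrossing.Microcanonical
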